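import Summits.ABC.ABC.Theorems.CuspFieldPencilGoldenCuspPlaces
import Summits.ABC.ABC.Theorems.CuspFieldPencilGoldenFromNFPencil
import Summits.ABC.ABC.Theorems.PlacewiseSzpiroSingleTowerSzpiroBakerSinglePlace
import Literature.Barriers.ABC.BakerMethodBoundsStewartTijdemanProofs
import HarnessLib

/-!
# Golden cusp shadow, FILE B — the cusp data of `X₁(5)` fed to the one-ratio place lemmas

Summits-side helper (theorems only; no named fact). Pairwise coprimality of `u, w, Q` is REUSED from the landed module
`CuspFieldPencilGoldenFromNFPencil` (`GoldenFromNFPencil.isCoprime_quadForm_left/right`, gate dedup), which is this file's only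
`Theses`-cone import. FILE B of three
(`CuspFieldPencilGoldenCuspPlaces` ⟵ `CuspFieldPencilGoldenCuspData` ⟵ `CuspFieldPencilGoldenCuspShadow`) proving the
crux stmt-ABC-26026 `CuspFieldPencil.GoldenCuspShadow`.

* §1 algebra of the cusp data: the hidden relation `t0 : w² + Q = u(u − 11w)` (`Q = u² − 11uw − w²`), pairwise
  coprimality of `u, w, Q` for coprime `u, w` and `|rad(u·w·Q)| = |rad u|·|rad w|·|rad Q|` (both reused from
  `GoldenFromNFPencil`);
* §2 the hypotheses of FILE A's `orl_arch` / `orl_padic_dvd` at `(y, z, s) = (|Q|, w², −sgn Q)` (dirty member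
  `m = u(u − 11w)`, divisor `d = |u|`): coprimality, `1 < |Q|·w²` off the escape `u = 11w`, `m ≠ 0`, `|u| ∣ |m|`,
  and the escape itself (`u = 11w` coprime ⇒ `max(|u|,|w|) = 11`);
* §3 the two cusp consequences `log|u| ≤ Θ₀·Y·3Σ_{p∣u} p` and `log max(|u|,|w|) ≤ log|u| + log 12 + Θ₀·Y`,
  the bound `Θ₀ ≤ K·C_η·R^η` (`SingleTowerSzpiroLine.theta_zero_le_mul_rpow`) and radical bookkeeping
  (`1 + 3Σ_{p∣u} p ≤ 4·rad u`).

HONESTY. Baker-class bookkeeping under a hypothesis `(hP : PastenApproximationBound K)`; nothing here is abc.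
References: [cite: Pasten2024, Theorem 2.1, §5]; [cite: EvertseGyory2015, Thm 4.2.1 p. 68, §4.6]; [folklore].
-/

set_option linter.dupNamespace false

noncomputable section

open Finset Real Height
open Literature.NumberTheory.DiophantineGeometry
open Literature.NumberTheory.DiophantineGeometry.Dioph
open Literature.NumberTheory.DiophantineGeometry.Pasten
open Literature.Barriers.ABC

namespace Summit.ABC.ABC.Theorems

namespace GoldenCuspShadowBaker

/-! ## §1 Algebra of the cusp data (pairwise coprimality from `GoldenFromNFPencil`) -/

/-- `t0 : w² + Q = u(u − 11w)` — the hidden relation at the cusp `t = 0`. -/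
theorem t0 (u w : ℤ) : w ^ 2 + (u ^ 2 - 11 * u * w - w ^ 2) = (u * (u - 11 * w)) := by
  ring

/-! ## §2 Cusp data: the hypotheses of A1/A2 at `(y, z, s) = (|Q|, w², −sgn Q)`, `m = M`, `d = |u|` -/

/-- **B1 [XS]** the dirty member of the call IS `M = u(u − 11w)`: `w² − (−sgn Q)·|Q| = w² + Q` (R10 `Int.sign_mul_natAbs`, `t0`). -/
theorem mem_eq_call (u w : ℤ) :
    ((w.natAbs ^ 2 : ℕ) : ℤ) - (-((u ^ 2 - 11 * u * w - w ^ 2)).sign) * (((u ^ 2 - 11 * u * w - w ^ 2).natAbs : ℕ) : ℤ) = (u * (u - 11 * w)) := by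
  rw [Nat.cast_pow, Int.natAbs_sq, neg_mul, sub_neg_eq_add, Int.sign_mul_natAbs]
  exact t0 u w

/-- **B2 [XS]** the sign is admissible: `Q ≠ 0 ⇒ −sgn Q = 1 ∨ −sgn Q = −1`. -/
theorem neg_sign_cases {u w : ℤ} (hQ : (u ^ 2 - 11 * u * w - w ^ 2) ≠ 0) : -((u ^ 2 - 11 * u * w - w ^ 2)).sign = 1 ∨ -((u ^ 2 - 11 * u * w - w ^ 2)).sign = -1 := by
  rcases lt_or_gt_of_ne hQ with h | h
  · left; rw [Int.sign_eq_neg_one_of_neg h]; norm_num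
  · right; rw [Int.sign_eq_one_of_pos h]

/-- **B3 [XS]** `gcd(|Q|, w²) = 1` (`GoldenFromNFPencil.isCoprime_quadForm_right`, `Int.isCoprime_iff_gcd_eq_one`, `Nat.Coprime.pow_right`). -/
theorem coprime_call {u w : ℤ} (h : IsCoprime u w) : ((u ^ 2 - 11 * u * w - w ^ 2).natAbs).Coprime (w.natAbs ^ 2) := by
  -- proof recycled from k1-GEN4 `coprime_Q_wsq` / k2-GEN4 `coprime_xy_u`
  have h1 : Int.gcd ((u ^ 2 - 11 * u * w - w ^ 2)) w = 1 := Int.isCoprime_iff_gcd_eq_one.mp (GoldenFromNFPencil.isCoprime_quadForm_right h).symm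
  exact Nat.Coprime.pow_right 2 h1

/-- **B4 [S−]** `|Q|·w² > 1` off the escape: `|Q| w² = 1` forces `w = ±1`, `u(u ∓ 11) = 1 + Q ∈ {0, 2}`; `0` is the
escape `u = 11w`, `2` has no integer solution. -/
theorem one_lt_call {u w : ℤ} (h : IsCoprime u w) (h0 : u * w * (u ^ 2 - 11 * u * w - w ^ 2) ≠ 0) (hne : u - 11 * w ≠ 0) :
    1 < (u ^ 2 - 11 * u * w - w ^ 2).natAbs * w.natAbs ^ 2 := by
  have hu : u ≠ 0 := by rintro rfl; simp at h0
  have hw : w ≠ 0 := by rintro rfl; simp at h0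
  have hQ : (u ^ 2 - 11 * u * w - w ^ 2) ≠ 0 := by intro hq; apply h0; rw [hq, mul_zero]
  have h1 : 1 ≤ (u ^ 2 - 11 * u * w - w ^ 2).natAbs := Nat.one_le_iff_ne_zero.mpr (Int.natAbs_ne_zero.mpr hQ)
  have h2 : 1 ≤ w.natAbs := Nat.one_le_iff_ne_zero.mpr (Int.natAbs_ne_zero.mpr hw)
  have h2' : 1 ≤ w.natAbs ^ 2 := Nat.one_le_pow _ _ h2
  by_contra hcon
  push Not at hcon
  have hQ1 : (u ^ 2 - 11 * u * w - w ^ 2).natAbs = 1 := by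
    have : (u ^ 2 - 11 * u * w - w ^ 2).natAbs ≤ 1 :=
      calc (u ^ 2 - 11 * u * w - w ^ 2).natAbs = (u ^ 2 - 11 * u * w - w ^ 2).natAbs * 1 := (mul_one _).symm
        _ ≤ (u ^ 2 - 11 * u * w - w ^ 2).natAbs * w.natAbs ^ 2 := Nat.mul_le_mul_left _ h2'
        _ ≤ 1 := hcon
    omega
  have hw1 : w.natAbs = 1 := by
    have hle : w.natAbs ^ 2 ≤ 1 :=
      calc w.natAbs ^ 2 = 1 * w.natAbs ^ 2 := (one_mul _).symm
        _ ≤ (u ^ 2 - 11 * u * w - w ^ 2).natAbs * w.natAbs ^ 2 := Nat.mul_le_mul_right _ h1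
        _ ≤ 1 := hcon
    by_contra hne1
    have h22 : 2 ≤ w.natAbs := by omega
    have h4 : 2 ^ 2 ≤ w.natAbs ^ 2 := Nat.pow_le_pow_left h22 2
    norm_num at h4
    omega
  have hw' : w = 1 ∨ w = -1 := by
    have := Int.natAbs_eq_iff.mp hw1
    push_cast at this
    exact this
  have hq' : (u ^ 2 - 11 * u * w - w ^ 2) = 1 ∨ (u ^ 2 - 11 * u * w - w ^ 2) = -1 := by
    have := Int.natAbs_eq_iff.mp hQ1
    push_cast at this
    exact this
  rcases hw' with rfl | rfl <;> rcases hq' with hq | hq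
  · -- `w = 1`, `Q = 1`: `(2u − 11)² = 129`, impossible
    have ht : (2 * u - 11) ^ 2 = 129 := by linear_combination 4 * hq
    rcases (by omega : (2 * u - 11 ≤ -12) ∨ (-11 ≤ 2 * u - 11 ∧ 2 * u - 11 ≤ 0) ∨
        (0 ≤ 2 * u - 11 ∧ 2 * u - 11 ≤ 11) ∨ 12 ≤ 2 * u - 11) with ht' | ht' | ht' | ht' <;> nlinarith
  · -- `w = 1`, `Q = −1`: `u(u − 11) = 0`, the escape
    have ht : u * (u - 11) = 0 := by linear_combination hq
    rcases mul_eq_zero.mp ht with h' | h'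
    · exact hu h'
    · exact hne (by linarith)
  · -- `w = −1`, `Q = 1`: `(2u + 11)² = 129`
    have ht : (2 * u + 11) ^ 2 = 129 := by linear_combination 4 * hq
    rcases (by omega : (2 * u + 11 ≤ -12) ∨ (-11 ≤ 2 * u + 11 ∧ 2 * u + 11 ≤ 0) ∨
        (0 ≤ 2 * u + 11 ∧ 2 * u + 11 ≤ 11) ∨ 12 ≤ 2 * u + 11) with ht' | ht' | ht' | ht' <;> nlinarith
  · -- `w = −1`, `Q = −1`: `u(u + 11) = 0`, the escape `(−11, −1)`
    have ht : u * (u + 11) = 0 := by linear_combination hq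
    rcases mul_eq_zero.mp ht with h' | h'
    · exact hu h'
    · exact hne (by linarith)

/-- **B5 [XS]** `M ≠ 0` off the escape (`u ≠ 0`, `u ≠ 11w`), in the shape A1/A2 want. -/
theorem mem_ne_zero_call {u w : ℤ} (h0 : u * w * (u ^ 2 - 11 * u * w - w ^ 2) ≠ 0) (hne : u - 11 * w ≠ 0) :
    ((w.natAbs ^ 2 : ℕ) : ℤ) - (-((u ^ 2 - 11 * u * w - w ^ 2)).sign) * (((u ^ 2 - 11 * u * w - w ^ 2).natAbs : ℕ) : ℤ) ≠ 0 := by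
  rw [mem_eq_call]
  have hu : u ≠ 0 := by rintro rfl; simp at h0
  exact mul_ne_zero hu hne

/-- **B6 [XS]** `|u| ∣ |M|` (R10 `Int.natAbs_mul`). -/
theorem natAbs_dvd_mem (u w : ℤ) : u.natAbs ∣ ((u * (u - 11 * w))).natAbs := by
  rw [Int.natAbs_mul]; exact dvd_mul_right _ _

/-- **B7 [XS]** the escape `u = 11w` forces `(u,w) = ±(11,1)` by coprimality, so `H = 11`. -/
theorem escape {u w : ℤ} (h : IsCoprime u w) (he : u - 11 * w = 0) : (max |(u : ℝ)| |(w : ℝ)|) = 11 := by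
  have hu : u = 11 * w := sub_eq_zero.mp he
  rw [hu] at h
  have hw : IsUnit w := isCoprime_self.mp h.of_mul_left_right
  have key : ∀ a b : ℝ, |a| = 11 → |b| = 1 → max |a| |b| = 11 := by
    intro a b ha hb; rw [ha, hb]; exact max_eq_left (by norm_num)
  rcases Int.isUnit_iff.mp hw with hw1 | hw1
  · refine key _ _ ?_ ?_
    · rw [hu, hw1]; push_cast; exact abs_of_nonneg (by norm_num)
    · rw [hw1]; push_cast; exact abs_one
  · refine key _ _ ?_ ?_
    · rw [hu, hw1]; push_cast; rw [abs_neg]; exact abs_of_nonneg (by norm_num)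
    · rw [hw1]; push_cast; rw [abs_neg]; exact abs_one

/-! ## §3 The two cusp consequences, `Θ₀ ≪ R^η`, radical bookkeeping -/

/-- **C1 [XS after A2 + B1–B6]** `log|u| ≤ Θ₀ · Y · 3Σ_{p∣u} p` (`log|u| = log (u.natAbs : ℝ)` by `Nat.cast_natAbs`/`Int.cast_abs`). -/
theorem cusp_padic {K : ℝ} (hK : 1 ≤ K) (hP : PastenApproximationBound K) {u w : ℤ}
    (h : IsCoprime u w) (h0 : u * w * (u ^ 2 - 11 * u * w - w ^ 2) ≠ 0) (hne : u - 11 * w ≠ 0) :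
    Real.log |(u : ℝ)| ≤ (theta K (u ^ 2 - 11 * u * w - w ^ 2).natAbs (w.natAbs ^ 2) 0) * (Real.log (max (Real.exp 1) (Real.log (((u ^ 2 - 11 * u * w - w ^ 2).natAbs : ℕ) : ℝ) + Real.log (((w.natAbs ^ 2 : ℕ)) : ℝ)))) * (3 * ∑ p ∈ u.natAbs.primeFactors, (p : ℝ)) := by
  have hw : w ≠ 0 := by rintro rfl; simp at h0
  have hQ : (u ^ 2 - 11 * u * w - w ^ 2) ≠ 0 := by intro hq; apply h0; rw [hq, mul_zero]
  have hy : (u ^ 2 - 11 * u * w - w ^ 2).natAbs ≠ 0 := Int.natAbs_ne_zero.mpr hQ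
  have hz : w.natAbs ^ 2 ≠ 0 := pow_ne_zero _ (Int.natAbs_ne_zero.mpr hw)
  have hd : u.natAbs ∣ (((w.natAbs ^ 2 : ℕ) : ℤ) - (-((u ^ 2 - 11 * u * w - w ^ 2)).sign) * (((u ^ 2 - 11 * u * w - w ^ 2).natAbs : ℕ) : ℤ)).natAbs := by
    rw [mem_eq_call]; exact natAbs_dvd_mem u w
  have key := orl_padic_dvd hK hP hy hz (coprime_call h) (one_lt_call h h0 hne) (neg_sign_cases hQ)
    (mem_ne_zero_call h0 hne) hd
  have hcast : Real.log |(u : ℝ)| = Real.log (u.natAbs : ℝ) := by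
    rw [Nat.cast_natAbs, Int.cast_abs]
  rw [hcast]
  exact key

/-- **C2 [S]** the regime-free transfer: `log H ≤ log|u| + log 12 + Θ₀·Y`
(`|w| ≤ |u|`: trivial as `Θ₀ Y ≥ 0`; `|u| < |w|`: A1 gives `2 log|w| < log|u| + log|u − 11w| + Θ₀Y` and `|u − 11w| < 12|w|`). -/
theorem cusp_transfer {K : ℝ} (hK : 1 ≤ K) (hP : PastenApproximationBound K) {u w : ℤ}
    (h : IsCoprime u w) (h0 : u * w * (u ^ 2 - 11 * u * w - w ^ 2) ≠ 0) (hne : u - 11 * w ≠ 0) :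
    Real.log ((max |(u : ℝ)| |(w : ℝ)|)) ≤ Real.log |(u : ℝ)| + Real.log 12 + (theta K (u ^ 2 - 11 * u * w - w ^ 2).natAbs (w.natAbs ^ 2) 0) * (Real.log (max (Real.exp 1) (Real.log (((u ^ 2 - 11 * u * w - w ^ 2).natAbs : ℕ) : ℝ) + Real.log (((w.natAbs ^ 2 : ℕ)) : ℝ)))) := by
  have hu : u ≠ 0 := by rintro rfl; simp at h0
  have hw : w ≠ 0 := by rintro rfl; simp at h0
  have hQ : (u ^ 2 - 11 * u * w - w ^ 2) ≠ 0 := by intro hq; apply h0; rw [hq, mul_zero]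
  have hy : (u ^ 2 - 11 * u * w - w ^ 2).natAbs ≠ 0 := Int.natAbs_ne_zero.mpr hQ
  have hz : w.natAbs ^ 2 ≠ 0 := pow_ne_zero _ (Int.natAbs_ne_zero.mpr hw)
  have hTY : 0 ≤ (theta K (u ^ 2 - 11 * u * w - w ^ 2).natAbs (w.natAbs ^ 2) 0) * (Real.log (max (Real.exp 1) (Real.log (((u ^ 2 - 11 * u * w - w ^ 2).natAbs : ℕ) : ℝ) + Real.log (((w.natAbs ^ 2 : ℕ)) : ℝ)))) :=
    mul_nonneg (theta_nonneg (zero_le_one.trans hK) _ _ _) (zero_le_one.trans (one_le_log_max_exp _))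
  have h12 : (0 : ℝ) ≤ Real.log 12 := Real.log_nonneg (by norm_num)
  rcases le_or_gt |(w : ℝ)| |(u : ℝ)| with hle | hlt
  · rw [show (max |(u : ℝ)| |(w : ℝ)|) = |(u : ℝ)| from max_eq_left hle]; linarith
  · rw [show (max |(u : ℝ)| |(w : ℝ)|) = |(w : ℝ)| from max_eq_right hlt.le]
    have key : Real.log (((w.natAbs ^ 2 : ℕ)) : ℝ) - Real.log |(((u * (u - 11 * w)) : ℤ) : ℝ)| < (theta K (u ^ 2 - 11 * u * w - w ^ 2).natAbs (w.natAbs ^ 2) 0) * (Real.log (max (Real.exp 1) (Real.log (((u ^ 2 - 11 * u * w - w ^ 2).natAbs : ℕ) : ℝ) + Real.log (((w.natAbs ^ 2 : ℕ)) : ℝ)))) := by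
      have := orl_arch hK hP hy hz (coprime_call h) (one_lt_call h h0 hne) (neg_sign_cases hQ)
        (mem_ne_zero_call h0 hne)
      rwa [mem_eq_call] at this
    have hu' : (u : ℝ) ≠ 0 := by exact_mod_cast hu
    have hw' : (w : ℝ) ≠ 0 := by exact_mod_cast hw
    have hne' : (u : ℝ) - 11 * w ≠ 0 := by exact_mod_cast hne
    have h1 : Real.log (((w.natAbs ^ 2 : ℕ)) : ℝ) = 2 * Real.log |(w : ℝ)| := by
      rw [Nat.cast_pow, Nat.cast_natAbs, Int.cast_abs, Real.log_pow]; norm_num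
    have h2 : Real.log |(((u * (u - 11 * w)) : ℤ) : ℝ)| = Real.log |(u : ℝ)| + Real.log |(u : ℝ) - 11 * w| := by
      show Real.log |((u * (u - 11 * w) : ℤ) : ℝ)| = _
      push_cast
      rw [abs_mul, Real.log_mul (abs_ne_zero.mpr hu') (abs_ne_zero.mpr hne')]
    have h3 : |(u : ℝ) - 11 * w| < 12 * |(w : ℝ)| := by
      have := abs_sub (u : ℝ) (11 * w)
      rw [abs_mul, abs_of_pos (by norm_num : (0:ℝ) < 11)] at this
      linarith
    have h4 : Real.log |(u : ℝ) - 11 * w| ≤ Real.log 12 + Real.log |(w : ℝ)| := by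
      rw [← Real.log_mul (by norm_num) (abs_ne_zero.mpr hw')]
      exact Real.log_le_log (abs_pos.mpr hne') h3.le
    nth_rw 1 [h1] at key
    rw [h2] at key
    linarith

/-- **D1 [S]** radical bookkeeping for R4: `rad |Q| w² |u| = rad(u·w·Q)` in `ℕ`
(`rad_def`, `Nat.primeFactors_mul/pow` or `Nat.radical` multiplicativity, `Int.natAbs_mul/pow`, `Int.radical_natAbs_eq_radical`). -/
theorem rad_call_eq {u w : ℤ} (h0 : u * w * (u ^ 2 - 11 * u * w - w ^ 2) ≠ 0) :
    rad (u ^ 2 - 11 * u * w - w ^ 2).natAbs (w.natAbs ^ 2) u.natAbs = (UniqueFactorizationMonoid.radical (u * w * (u ^ 2 - 11 * u * w - w ^ 2))).natAbs := by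
  have hu : u.natAbs ≠ 0 := Int.natAbs_ne_zero.mpr (by rintro rfl; simp at h0)
  have hw : w.natAbs ≠ 0 := Int.natAbs_ne_zero.mpr (by rintro rfl; simp at h0)
  have hQ : (u ^ 2 - 11 * u * w - w ^ 2).natAbs ≠ 0 := Int.natAbs_ne_zero.mpr (by intro hq; apply h0; rw [hq, mul_zero])
  rw [rad, ← Int.radical_natAbs_eq_radical, Int.natAbs_natCast, Int.natAbs_mul, Int.natAbs_mul,
    Nat.radical_eq_prod_primeFactors, Nat.radical_eq_prod_primeFactors,
    Nat.primeFactors_mul (mul_ne_zero hQ (pow_ne_zero 2 hw)) hu, Nat.primeFactors_mul hQ (pow_ne_zero 2 hw),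
    Nat.primeFactors_pow _ two_ne_zero, Nat.primeFactors_mul (mul_ne_zero hu hw) hQ, Nat.primeFactors_mul hu hw]
  congr 1
  ext p; simp only [Finset.mem_union]; tauto

/-- **D2 [XS, PROVED modulo D1]** `Θ₀ ≤ K·C·R^η` — receipt R4 + D1. -/
theorem theta_call_le {K C η : ℝ} (hK : 1 ≤ K) (hη : 0 ≤ η)
    (hC : ∀ S : Finset ℕ, (∀ p ∈ S, p.Prime) → ∏ p ∈ S, K * Real.log p / (p : ℝ) ^ η ≤ C)
    {u w : ℤ} (h : IsCoprime u w) (h0 : u * w * (u ^ 2 - 11 * u * w - w ^ 2) ≠ 0) :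
    (theta K (u ^ 2 - 11 * u * w - w ^ 2).natAbs (w.natAbs ^ 2) 0) ≤ K * C * (((UniqueFactorizationMonoid.radical (u * w * (u ^ 2 - 11 * u * w - w ^ 2))).natAbs : ℕ) : ℝ) ^ η := by
  have hu : u.natAbs ≠ 0 := Int.natAbs_ne_zero.mpr (by rintro rfl; simp at h0)
  have hw : w.natAbs ^ 2 ≠ 0 := pow_ne_zero _ (Int.natAbs_ne_zero.mpr (by rintro rfl; simp at h0))
  have hQ : (u ^ 2 - 11 * u * w - w ^ 2).natAbs ≠ 0 := Int.natAbs_ne_zero.mpr (by intro hq; apply h0; rw [hq, mul_zero])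
  have key := SingleTowerSzpiroLine.theta_zero_le_mul_rpow hK hη hC hQ hw (coprime_call h)
    (dvd_mul_right _ u.natAbs) (mul_ne_zero (mul_ne_zero hQ hw) hu)
  rwa [rad_call_eq h0] at key

/-- `rad z = ∏_{p ∣ z} p` as reals (`Int.radical_natAbs_eq_radical`, `Nat.radical_eq_prod_primeFactors`). -/
theorem natAbs_radical_cast (z : ℤ) :
    (((UniqueFactorizationMonoid.radical z).natAbs : ℕ) : ℝ) = ∏ p ∈ z.natAbs.primeFactors, (p : ℝ) := by
  -- proof recycled from k1-GEN4 `natAbs_radical_cast`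
  show (((UniqueFactorizationMonoid.radical z).natAbs : ℕ) : ℝ) = _
  rw [← Int.radical_natAbs_eq_radical, Int.natAbs_natCast, Nat.radical_eq_prod_primeFactors, Nat.cast_prod]

/-- `1 ≤ rad z` (empty product at `z = 0`). -/
theorem one_le_radR (z : ℤ) : 1 ≤ (((UniqueFactorizationMonoid.radical z).natAbs : ℕ) : ℝ) := by
  rw [natAbs_radical_cast z, ← Nat.cast_prod]
  have : 0 < ∏ p ∈ z.natAbs.primeFactors, p :=
    Finset.prod_pos fun p hp => (Nat.prime_of_mem_primeFactors hp).pos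
  exact Nat.one_le_cast.mpr (Nat.one_le_iff_ne_zero.mpr this.ne')

/-- `rad(u·w·Q) = rad u · rad w · rad Q` as reals (`GoldenFromNFPencil.natAbs_radical_prod`). [folklore] -/
theorem radR_prod {u w : ℤ} (h : IsCoprime u w) : (((UniqueFactorizationMonoid.radical (u * w * (u ^ 2 - 11 * u * w - w ^ 2))).natAbs : ℕ) : ℝ) = (((UniqueFactorizationMonoid.radical u).natAbs : ℕ) : ℝ) * (((UniqueFactorizationMonoid.radical w).natAbs : ℕ) : ℝ) * (((UniqueFactorizationMonoid.radical (u ^ 2 - 11 * u * w - w ^ 2)).natAbs : ℕ) : ℝ) := by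
  show (((UniqueFactorizationMonoid.radical (u * w * (u ^ 2 - 11 * u * w - w ^ 2))).natAbs : ℕ) : ℝ) =
    (((UniqueFactorizationMonoid.radical u).natAbs : ℕ) : ℝ) * (((UniqueFactorizationMonoid.radical w).natAbs : ℕ) : ℝ) *
      (((UniqueFactorizationMonoid.radical (u ^ 2 - 11 * u * w - w ^ 2)).natAbs : ℕ) : ℝ)
  rw [GoldenFromNFPencil.natAbs_radical_prod h, Nat.cast_mul, Nat.cast_mul]

/-- `rad u ≤ rad(u·w·Q)`. -/
theorem radR_le_radR_prod {u w : ℤ} (h : IsCoprime u w) : (((UniqueFactorizationMonoid.radical u).natAbs : ℕ) : ℝ) ≤ (((UniqueFactorizationMonoid.radical (u * w * (u ^ 2 - 11 * u * w - w ^ 2))).natAbs : ℕ) : ℝ) := by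
  have hb := one_le_radR w
  have hc := one_le_radR (u ^ 2 - 11 * u * w - w ^ 2)
  have h0u : 0 ≤ (((UniqueFactorizationMonoid.radical u).natAbs : ℕ) : ℝ) := Nat.cast_nonneg _
  rw [radR_prod h]
  exact (le_mul_of_one_le_right h0u hb).trans
    (le_mul_of_one_le_right (mul_nonneg h0u (zero_le_one.trans hb)) hc)

/-- **D3 [XS]** `1 + 3Σ_{p∣u} p ≤ 4·rad u` (R7 `sum_le_prod_of_two_le`, `rad u = ∏_{p∣u} p ≥ 1`). -/
theorem one_add_three_sum_le (u : ℤ) :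
    1 + 3 * ∑ p ∈ u.natAbs.primeFactors, (p : ℝ) ≤ 4 * (((UniqueFactorizationMonoid.radical u).natAbs : ℕ) : ℝ) := by
  rw [natAbs_radical_cast u]
  have hs : ∑ p ∈ u.natAbs.primeFactors, p ≤ ∏ p ∈ u.natAbs.primeFactors, p :=
    sum_le_prod_of_two_le fun p hp => (Nat.prime_of_mem_primeFactors hp).two_le
  have hs' : (∑ p ∈ u.natAbs.primeFactors, (p : ℝ)) ≤ ∏ p ∈ u.natAbs.primeFactors, (p : ℝ) :=
    calc (∑ p ∈ u.natAbs.primeFactors, (p : ℝ)) = ((∑ p ∈ u.natAbs.primeFactors, p : ℕ) : ℝ) :=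
          (Nat.cast_sum _ _).symm
      _ ≤ ((∏ p ∈ u.natAbs.primeFactors, p : ℕ) : ℝ) := Nat.cast_le.mpr hs
      _ = ∏ p ∈ u.natAbs.primeFactors, (p : ℝ) := Nat.cast_prod _ _
  have h1 : (1 : ℝ) ≤ ∏ p ∈ u.natAbs.primeFactors, (p : ℝ) := by
    have : 0 < ∏ p ∈ u.natAbs.primeFactors, p :=
      Finset.prod_pos fun p hp => (Nat.prime_of_mem_primeFactors hp).pos
    rw [← Nat.cast_prod]
    exact Nat.one_le_cast.mpr (Nat.one_le_iff_ne_zero.mpr this.ne')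
  linarith

end GoldenCuspShadowBaker

end Summit.ABC.ABC.Theorems

end
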